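/-
Origin: expansion seat `planner-pub-hodgecm-pv08-g6-0`, handover #2 2026-08-18T08:35:20Z (`HOME/pub-hodgecm-pv08-g6/lean/Pv08g6/SeesawSchwartzArch.lean`, md5 c0f79742, 150 lines);
landed by the gen-7 packager in gate run 27 as `HodgeCM/Model/Toy/SeesawSchwartzArch.lean` (verbatim).
-/
/-
Origin: HOME/pub-hodgecm-pv08-g6/lean/Pv08g6/SeesawSchwartzArch.lean — session planner-pub-hodgecm-pv08-g6-0 (unit pub-hodgecm-pv08-g6,
DAG-NODE PROVER #08 gen 6).  TOY / WITNESS file: the archimedean-circle hypotheses of `S5QautSeesawArch` §1 (period invariance =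
STRUCTURAL, type of `χ′_j` = D1, `ω`-covariance = D4, weight of the test vector) are THEOREMS in pv08-g5's honest two-sided
Schwartz–lattice model `Seesaw.SchwartzModel.model k₁ k₂` (`HodgeCM/Model/Toy/SeesawSchwartzModel.lean`, r25), and §1
(`QautSeesawArch.thetaLift₁_eq_zero_of_weight`) then yields the vanishing half of F5's weight selection WITHOUT Fourier
orthogonality.  Intended final place: `HodgeCM/Model/Toy/SeesawSchwartzArch.lean` (input of NOTHING).  Imports LANDED modules +
the pv08-g6 handover `S5QautSeesawArch` only.  Asserts nothing.
-/
import Summits.HodgeConjecture.HodgeCM.PerL34.S5QautSeesawArch_3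
import Summits.HodgeConjecture.HodgeCM.Model.Toy.SeesawSchwartzModel

/-!
# The archimedean-circle hypotheses of `S5QautSeesawArch` §1 in the honest Schwartz–lattice model

`S5QautSeesawArch.lean` (pv08-g6) proves PerL v5 ll. 362–364 ("`θ(φ_j, χ′_j)` vanishes unless the type of `φ_j` occurs in
`J⁺ ⊠ 1`") inside the S5 record from FOUR hypotheses on the archimedean circle `U(W_j)(ℝ) = U(1)` acting on `[U(W_j)]`:

* `hinv` — the period `∫_{[U(W_j)]} θ_φ(g,u) χ′(u) du` is invariant under translating `u` by the circle (STRUCTURAL);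
* `hχ`   — `χ′(c·u) = χ′(u) c^e` (D1, the infinity type of `χ′_j`);
* `hω`   — `ω(g, c·u) φ = ω(g, u) (ψ c)` (D4, `ω`-covariance: the circle acts on the test vector);
* `hlin` — `θ(ψ c, χ′) = c^k θ(φ, χ′)` (the test vector has weight `k`);

conclusion: `k ≠ -e ⟹ θ(φ, χ′)(g) = 0`.  Here all four are THEOREMS for pv08-g5's model (`G = ℝ`, `[U(W_j)] = ℝ/ℤ` with
its Haar probability measure, `𝒮_j = 𝓢(ℝ, ℂ)`, `ω_j(g,u) = e(k_j u) ·` translation by `g`, `χ′ = e(−m ·)`), with `e = -m`,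
`k = k₁`, `ψ c = c^{k₁} • φ`; so §1 gives `θ(φ, e(−m·)) = 0` for `m ≠ k₁` (`Arch.thetaLift₁_eq_zero_of_ne`), in agreement
with F5's direct computation `SchwartzModel.thetaLift₁_eq` (which also shows the period is NON-zero at `m = k₁`:
`thetaPeriod_bump_tmul_bump`), i.e. the hypothesis `k ≠ -e` of §1 is sharp.  The record fields of `QautSeesawArchBridge` at a real
place `b ≠ ι₁` (`period_r_j b`, `ch_r_j b`, `omega_r_j b`) have the same shape as those at `ι₁` (`period_rι_j`, `ch_rι_j`, `omega_rι_j`),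
so the theorems below witness both (with `(e, k) := (e_j b, wt_j b a)`, resp. `(-(1 + kW_j), weight of the Fock vector)`).

No new cited fact; Mathlib only (`AddCircle.homeomorphCircle`, `AddCircle.toCircle_add/_zsmul`, `fourier_apply`,
`MeasureTheory.integral_add_left_eq_self` for the Haar measure `AddCircle.haarAddCircle`).
-/

noncomputable section

open scoped SchwartzMap
open MeasureTheory AddCircle HodgeCM.PerL34.Seesaw

namespace HodgeCM
namespace PerL34
namespace Seesaw
namespace SchwartzModel
namespace Arch

variable (k₁ k₂ : ℤ)

/-- the point of `[U(W_j)] = ℝ/ℤ` under the archimedean circle element `c ∈ U(1)` (inverse of `AddCircle.toCircle`). -/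
def pt (c : Circle) : 𝕋 := (homeomorphCircle (T := (1 : ℝ)) one_ne_zero).symm c

/-- (Ported verbatim from the HodgeCMPerL package; no docstring in the source.) -/
@[simp] theorem toCircle_pt (c : Circle) : toCircle (pt c) = c := by
  rw [pt, ← homeomorphCircle_apply one_ne_zero, Homeomorph.apply_symm_apply]

/-- the archimedean circle `U(1)` acting on `[U(W_j)] = ℝ/ℤ` by translation. -/
def circ (c : Circle) (u : 𝕋) : 𝕋 := pt c + u

/-- **STRUCTURAL hypothesis `hinv` is a theorem**: the Haar period is translation invariant. -/
theorem period_circ (f : 𝕋 → ℂ) (c : Circle) : ∫ u, f (circ c u) ∂haarAddCircle = ∫ u, f u ∂haarAddCircle :=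
  integral_add_left_eq_self f (pt c)

/-- **D1 hypothesis `hχ` is a theorem**: `χ′ = e(−m ·)` has type `−m` under the circle. -/
theorem fourier_circ (m : ℤ) (c : Circle) (u : 𝕋) :
    fourier (-m) (circ c u) = fourier (-m) u * (c : ℂ) ^ (-m) := by
  rw [circ, fourier_apply, fourier_apply, smul_add, toCircle_add, toCircle_zsmul (pt c), toCircle_pt, Circle.coe_mul,
    Circle.coe_zpow, mul_comm]

/-- **D4 hypothesis `hω` is a theorem**: `ω₁(g, c·u) φ = ω₁(g, u) (c^{k₁} • φ)`. -/
theorem omega₁_circ (c : Circle) (g : ℝ) (u : 𝕋) (φ : Sch) :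
    (model k₁ k₂).ω₁ g (circ c u) φ = (model k₁ k₂).ω₁ g u (((c : ℂ) ^ k₁) • φ) := by
  show act k₁ g (circ c u) φ = act k₁ g u (((c : ℂ) ^ k₁) • φ)
  ext x
  rw [act_apply, act_apply, smul_apply, smul_eq_mul, circ, fourier_apply, fourier_apply, smul_add,
    toCircle_add, toCircle_zsmul (pt c), toCircle_pt, Circle.coe_mul, Circle.coe_zpow]
  ring

/-- (Ported verbatim from the HodgeCMPerL package; no docstring in the source.) -/
theorem omega₂_circ (c : Circle) (g : ℝ) (u : 𝕋) (φ : Sch) :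
    (model k₁ k₂).ω₂ g (circ c u) φ = (model k₁ k₂).ω₂ g u (((c : ℂ) ^ k₂) • φ) := by
  show act k₂ g (circ c u) φ = act k₂ g u (((c : ℂ) ^ k₂) • φ)
  ext x
  rw [act_apply, act_apply, smul_apply, smul_eq_mul, circ, fourier_apply, fourier_apply, smul_add,
    toCircle_add, toCircle_zsmul (pt c), toCircle_pt, Circle.coe_mul, Circle.coe_zpow]
  ring

/-- the theta kernel is linear in the test vector (scalar case). -/
theorem thetaKernel₁_smul (s : ℂ) (φ : Sch) (g : ℝ) (u : 𝕋) :
    (model k₁ k₂).thetaKernel₁ (s • φ) g u = s * (model k₁ k₂).thetaKernel₁ φ g u := by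
  rw [thetaKernel₁_eq, thetaKernel₁_eq]
  simp only [smul_apply, smul_eq_mul]
  rw [tsum_mul_left]
  ring

/-- (Ported verbatim from the HodgeCMPerL package; no docstring in the source.) -/
theorem thetaKernel₂_smul (s : ℂ) (φ : Sch) (g : ℝ) (u : 𝕋) :
    (model k₁ k₂).thetaKernel₂ (s • φ) g u = s * (model k₁ k₂).thetaKernel₂ φ g u := by
  rw [thetaKernel₂_eq, thetaKernel₂_eq]
  simp only [smul_apply, smul_eq_mul]
  rw [tsum_mul_left]
  ring

/-- **weight hypothesis `hlin` is a theorem**: the lift is linear in the test vector. -/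
theorem thetaLift₁_smul (χ : 𝕋 → ℂ) (s : ℂ) (φ : Sch) (g : ℝ) :
    (model k₁ k₂).thetaLift₁ haarAddCircle χ (s • φ) g = s * (model k₁ k₂).thetaLift₁ haarAddCircle χ φ g := by
  show (∫ u, (model k₁ k₂).thetaKernel₁ (s • φ) g u * χ u ∂haarAddCircle) =
    s * ∫ u, (model k₁ k₂).thetaKernel₁ φ g u * χ u ∂haarAddCircle
  rw [← integral_const_mul]
  exact integral_congr_ae (Filter.Eventually.of_forall fun u => by simp only [thetaKernel₁_smul, mul_assoc])

/-- (Ported verbatim from the HodgeCMPerL package; no docstring in the source.) -/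
theorem thetaLift₂_smul (χ : 𝕋 → ℂ) (s : ℂ) (φ : Sch) (g : ℝ) :
    (model k₁ k₂).thetaLift₂ haarAddCircle χ (s • φ) g = s * (model k₁ k₂).thetaLift₂ haarAddCircle χ φ g := by
  show (∫ u, (model k₁ k₂).thetaKernel₂ (s • φ) g u * χ u ∂haarAddCircle) =
    s * ∫ u, (model k₁ k₂).thetaKernel₂ φ g u * χ u ∂haarAddCircle
  rw [← integral_const_mul]
  exact integral_congr_ae (Filter.Eventually.of_forall fun u => by simp only [thetaKernel₂_smul, mul_assoc])

/-- **§1 of `S5QautSeesawArch` in the honest model**: for `m ≠ k₁` the period of `θ_φ` against `e(−m ·)` VANISHES — derived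
from period invariance, the type of `χ′` and `ω`-covariance alone (pv08-g6 `QautSeesawArch.thetaLift₁_eq_zero_of_weight` with
`e = −m`, `k = k₁`), in agreement with F5's `SchwartzModel.thetaLift₁_eq`. -/
theorem thetaLift₁_eq_zero_of_ne (m : ℤ) (hm : m ≠ k₁) (φ : Sch) (g : ℝ) :
    (model k₁ k₂).thetaLift₁ haarAddCircle (fourier (-m)) φ g = 0 :=
  QautSeesawArch.thetaLift₁_eq_zero_of_weight (model k₁ k₂) haarAddCircle (fourier (-m)) circ (-m) k₁ φ
    (fun c => ((c : ℂ) ^ k₁) • φ) g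
    (fun c => period_circ (fun u => (model k₁ k₂).thetaKernel₁ φ g u * fourier (-m) u) c)
    (fun c u => fourier_circ m c u) (fun c u => omega₁_circ k₁ k₂ c g u φ)
    (fun c => thetaLift₁_smul k₁ k₂ _ _ φ g) (by omega)

/-- (Ported verbatim from the HodgeCMPerL package; no docstring in the source.) -/
theorem thetaLift₂_eq_zero_of_ne (m : ℤ) (hm : m ≠ k₂) (φ : Sch) (g : ℝ) :
    (model k₁ k₂).thetaLift₂ haarAddCircle (fourier (-m)) φ g = 0 :=
  QautSeesawArch.thetaLift₂_eq_zero_of_weight (model k₁ k₂) haarAddCircle (fourier (-m)) circ (-m) k₂ φ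
    (fun c => ((c : ℂ) ^ k₂) • φ) g
    (fun c => period_circ (fun u => (model k₁ k₂).thetaKernel₂ φ g u * fourier (-m) u) c)
    (fun c u => fourier_circ m c u) (fun c u => omega₂_circ k₁ k₂ c g u φ)
    (fun c => thetaLift₂_smul k₁ k₂ _ _ φ g) (by omega)

/-- … consistency with F5's direct computation (Fourier orthogonality): both give `0` off the weight. -/
theorem thetaLift₁_eq_zero_of_ne_agrees (m : ℤ) (hm : m ≠ k₁) (φ : Sch) (g : ℝ) :
    (model k₁ k₂).thetaLift₁ haarAddCircle (fourier (-m)) φ g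
      = (if m = k₁ then ∑' v : LZ, φ ((v : ℝ) - g) else 0) := by
  rw [thetaLift₁_eq_zero_of_ne k₁ k₂ m hm, if_neg hm]

/-- … and the hypothesis `k ≠ -e` of §1 is SHARP in the model: at `m = k₁` the period of `bump` at `g = 0` is `1 ≠ 0`. -/
theorem thetaLift₁_bump_self : (model k₁ k₂).thetaLift₁ haarAddCircle (fourier (-k₁)) bump 0 = 1 := by
  rw [thetaLift₁_eq, if_pos rfl]
  simp only [sub_zero]
  exact tsum_bump

end Arch
end SchwartzModel
end Seesaw
end PerL34
end HodgeCM
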